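import Summits.SmoothPoincare4.SmoothPoincare4.Theorems.SblfDescentRungOneHelperDxTorus
import Summits.SmoothPoincare4.SmoothPoincare4.Theorems.SblfDescentRungOneHelperDxCircle
import Summits.SmoothPoincare4.SmoothPoincare4.Theorems.SblfDescentRungOneHelperDxStep
import Literature.Topology.FourManifolds.Diffeotopy
import HarnessLib

/-!
# Disc extension, layer 3: the comparison family `Θ_w ∈ Diff(T²)` and the loop of a base circle

Auxiliary file of helper `helper_sliceGluing_discExtension` (apex leaf DX: extension of the
torus angular coordinate over the torus disc), line `Sketch`, crux `SblfDescent.RungOne`.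

(Crux item stmt-SmoothPoincare4-18531; skeleton `Cruxes/RungOne/Lines/Sketch.lean`.)

With the rigid coordinates `ΨT w : Fb ≅ 𝕊¹ × 𝕊¹` of the band fibres (layer 2) and a base point
`w₀` of the band annulus we form, on Mathlib's torus `T = Circle × Circle`:

* `Ψ0 w₀ : Fb → T` and `Φ0 w₀ : T → Fb`, the reference trivialisation of the fibre and its
  inverse (`Φ0_Ψ0`, `Ψ0_Φ0`, smooth, `surjective_mfderiv_Ψ0`);
* `ΘT w₀ w = Ψ_w ∘ Ψ_{w₀}⁻¹ ∈ Diff(T)` and its inverse `ΘTinv w₀ w` — the comparison of the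
  fibre over `w` with the reference fibre, read in rigid coordinates; jointly smooth in `(w, x)`
  over the band annulus (`contMDiffOn_ΘT`), jointly smooth along base circles together with the
  inverses (`contMDiff_ΘT_circle`, `contMDiff_ΘTinv_circle`), `ΘT w₀ w₀ = id`, and
  `(ΘT w₀ w (Ψ0 w₀ θ)).1 = aC (ιT (θ, w))` (`ΘT_Ψ0_fst`);
* `loopD`: the smooth based loop `t ↦ ΘT w₀ (R • circlePt (stepQ t))` of diffeomorphisms of `T`
  read along the base circle of radius `R = ‖w₀‖` through `w₀ = R • circlePt 0`, flattened to
  the identity near `t ≤ 1/4` and `t ≥ 3/4`, as a `Diffeotopy` — the input of the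
  Earle–Eells/Gramain fact `gramain_loopHomotopy_translationLoop_torus`.

Everything is folklore differential topology.
-/

set_option linter.dupNamespace false

noncomputable section

open scoped Manifold ContDiff Topology Real
open Set Function Metric Literature.Topology.FourManifolds

namespace Summit.SmoothPoincare4.SmoothPoincare4.Cruxes.RungOne.Sketch

namespace DiscExt

/-- Local notation: `𝔼 n` is the model Euclidean space `EuclideanSpace ℝ (Fin n)`. -/
local notation "𝔼 " n:arg => EuclideanSpace ℝ (Fin n)

/-- Local notation: `𝕊¹`, the unit circle of `ℝ²`. -/
local notation "𝕊¹" => (Metric.sphere (0 : EuclideanSpace ℝ (Fin 2)) (1 : ℝ))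

/-- Local notation: `𝕊²`, the unit sphere of `ℝ³`. -/
local notation "𝕊²" => (Metric.sphere (0 : EuclideanSpace ℝ (Fin 3)) (1 : ℝ))

/-- Local notation: the model with corners of the torus `Circle × Circle`. -/
local notation "𝓣" => (ModelWithCorners.prod (𝓡 1) (𝓡 1))

attribute [local instance] Literature.Topology.FourManifolds.fact_finrank_euclideanSpace_succ

section Setup

variable {X : Type} [TopologicalSpace X] [ChartedSpace (𝔼 4) X]
  {Fb : Type} [TopologicalSpace Fb] [ChartedSpace (𝔼 2) Fb]
  {f : X → 𝕊²} {v : 𝕊²} {ιT : Fb × 𝔼 2 → X}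
  {ν : 𝕊¹ × 𝔼 3 → X} {σ : ℝ} {g : ℝ → ℝ} {s₁ s₂ ε₂ : ℝ}
  {ιC : (𝕊¹ × 𝕊¹) × (𝕊¹ × ℝ) → X} {aC bC : X → 𝕊¹}

/-! ### The reference trivialisation -/

variable (ιT aC bC) in
/-- **The reference trivialisation** `Ψ0 w₀ θ = (aC, bC) (ιT (θ, w₀))`, read in `Circle × Circle`.
[folklore] -/
def Ψ0 (w₀ : 𝔼 2) (θ : Fb) : Circle × Circle := torusDiffeo (ΨT ιT aC bC w₀ θ)

/-- `Ψ0 w₀` is smooth. [folklore] -/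
theorem contMDiff_Ψ0 (hT : IsTorusSideProduct f v ιT) (hC : IsRigidCollar f v ν σ g s₁ s₂ ε₂ ιC aC bC)
    (hv0 : (v : 𝔼 3) 0 = 0) (hv1 : (v : 𝔼 3) 1 = 0) {w₀ : 𝔼 2} (h1 : s₁ < sT w₀) (h2 : sT w₀ < s₂) :
    ContMDiff (𝓡 2) 𝓣 ∞ (Ψ0 ιT aC bC w₀) :=
  torusDiffeo.contMDiff.comp (contMDiff_ΨT hT hC hv0 hv1 h1 h2)

variable [Nonempty Fb]

variable (v ιT ιC) in
/-- **The inverse of the reference trivialisation.** [folklore] -/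
def Φ0 (w₀ : 𝔼 2) (x : Circle × Circle) : Fb := ΦT v ιT ιC w₀ (torusDiffeo.symm x)

/-- `Φ0 ∘ Ψ0 = id`. [folklore] -/
theorem Φ0_Ψ0 (hT : IsTorusSideProduct f v ιT) (hC : IsRigidCollar f v ν σ g s₁ s₂ ε₂ ιC aC bC)
    (hv0 : (v : 𝔼 3) 0 = 0) (hv1 : (v : 𝔼 3) 1 = 0) {w₀ : 𝔼 2} (hw : w₀ ≠ 0) (h1 : s₁ < sT w₀)
    (h2 : sT w₀ < s₂) (θ : Fb) : Φ0 v ιT ιC w₀ (Ψ0 ιT aC bC w₀ θ) = θ := by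
  rw [Φ0, Ψ0, Diffeomorph.symm_apply_apply, ΦT_ΨT hT hC hv0 hv1 hw h1 h2]

/-- `Ψ0 ∘ Φ0 = id`. [folklore] -/
theorem Ψ0_Φ0 (hT : IsTorusSideProduct f v ιT) (hC : IsRigidCollar f v ν σ g s₁ s₂ ε₂ ιC aC bC)
    (hv0 : (v : 𝔼 3) 0 = 0) (hv1 : (v : 𝔼 3) 1 = 0) {w₀ : 𝔼 2} (hw : w₀ ≠ 0) (h1 : s₁ < sT w₀)
    (h2 : sT w₀ < s₂) (x : Circle × Circle) : Ψ0 ιT aC bC w₀ (Φ0 v ιT ιC w₀ x) = x := by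
  rw [Φ0, Ψ0, ΨT_ΦT hT hC hv0 hv1 hw h1 h2, Diffeomorph.apply_symm_apply]

/-- `Φ0 w₀` is smooth. [folklore] -/
theorem contMDiff_Φ0 (hT : IsTorusSideProduct f v ιT) (hC : IsRigidCollar f v ν σ g s₁ s₂ ε₂ ιC aC bC)
    (hv0 : (v : 𝔼 3) 0 = 0) (hv1 : (v : 𝔼 3) 1 = 0) {w₀ : 𝔼 2} (h1 : s₁ < sT w₀) (h2 : sT w₀ < s₂) :
    ContMDiff 𝓣 (𝓡 2) ∞ (Φ0 v ιT ιC w₀) :=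
  (contMDiff_ΦT hT hC hv0 hv1 h1 h2).comp torusDiffeo.symm.contMDiff

/-- **`Ψ0 w₀` has surjective differential** (it is a diffeomorphism `Fb ≅ T`). [folklore] -/
theorem surjective_mfderiv_Ψ0 [IsManifold (𝓡 2) ∞ Fb] (hT : IsTorusSideProduct f v ιT)
    (hC : IsRigidCollar f v ν σ g s₁ s₂ ε₂ ιC aC bC) (hv0 : (v : 𝔼 3) 0 = 0) (hv1 : (v : 𝔼 3) 1 = 0)
    {w₀ : 𝔼 2} (hw : w₀ ≠ 0) (h1 : s₁ < sT w₀) (h2 : sT w₀ < s₂) (θ : Fb) :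
    Surjective (mfderiv (𝓡 2) 𝓣 (Ψ0 ιT aC bC w₀) θ) :=
  surjective_mfderiv_of_inverse (contMDiff_Ψ0 hT hC hv0 hv1 h1 h2).contMDiffAt
    (contMDiff_Φ0 hT hC hv0 hv1 h1 h2).contMDiffAt (Φ0_Ψ0 hT hC hv0 hv1 hw h1 h2 θ)
    (Ψ0_Φ0 hT hC hv0 hv1 hw h1 h2)

/-! ### The comparison family -/

variable (v ιT ιC aC bC) in
/-- **The comparison diffeomorphism** `ΘT w₀ w = Ψ_w ∘ Ψ_{w₀}⁻¹` of `T = Circle × Circle`.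
[folklore] -/
def ΘT (w₀ w : 𝔼 2) (x : Circle × Circle) : Circle × Circle :=
  torusDiffeo (ΨT ιT aC bC w (ΦT v ιT ιC w₀ (torusDiffeo.symm x)))

variable (v ιT ιC aC bC) in
/-- **The inverse comparison diffeomorphism** `ΘTinv w₀ w = Ψ_{w₀} ∘ Ψ_w⁻¹`. [folklore] -/
def ΘTinv (w₀ w : 𝔼 2) (x : Circle × Circle) : Circle × Circle :=
  torusDiffeo (ΨT ιT aC bC w₀ (ΦT v ιT ιC w (torusDiffeo.symm x)))

/-- `ΘTinv ∘ ΘT = id`. [folklore] -/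
theorem ΘTinv_ΘT (hT : IsTorusSideProduct f v ιT) (hC : IsRigidCollar f v ν σ g s₁ s₂ ε₂ ιC aC bC)
    (hv0 : (v : 𝔼 3) 0 = 0) (hv1 : (v : 𝔼 3) 1 = 0) {w₀ w : 𝔼 2} (hw₀ : w₀ ≠ 0) (h1₀ : s₁ < sT w₀)
    (h2₀ : sT w₀ < s₂) (hw : w ≠ 0) (h1 : s₁ < sT w) (h2 : sT w < s₂) (x : Circle × Circle) :
    ΘTinv v ιT ιC aC bC w₀ w (ΘT v ιT ιC aC bC w₀ w x) = x := by
  rw [ΘT, ΘTinv, Diffeomorph.symm_apply_apply, ΦT_ΨT hT hC hv0 hv1 hw h1 h2,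
    ΨT_ΦT hT hC hv0 hv1 hw₀ h1₀ h2₀, Diffeomorph.apply_symm_apply]

/-- `ΘT ∘ ΘTinv = id`. [folklore] -/
theorem ΘT_ΘTinv (hT : IsTorusSideProduct f v ιT) (hC : IsRigidCollar f v ν σ g s₁ s₂ ε₂ ιC aC bC)
    (hv0 : (v : 𝔼 3) 0 = 0) (hv1 : (v : 𝔼 3) 1 = 0) {w₀ w : 𝔼 2} (hw₀ : w₀ ≠ 0) (h1₀ : s₁ < sT w₀)
    (h2₀ : sT w₀ < s₂) (hw : w ≠ 0) (h1 : s₁ < sT w) (h2 : sT w < s₂) (x : Circle × Circle) :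
    ΘT v ιT ιC aC bC w₀ w (ΘTinv v ιT ιC aC bC w₀ w x) = x := by
  rw [ΘT, ΘTinv, Diffeomorph.symm_apply_apply, ΦT_ΨT hT hC hv0 hv1 hw₀ h1₀ h2₀,
    ΨT_ΦT hT hC hv0 hv1 hw h1 h2, Diffeomorph.apply_symm_apply]

/-- **`ΘT w₀ w₀ = id`.** [folklore] -/
theorem ΘT_self (hT : IsTorusSideProduct f v ιT) (hC : IsRigidCollar f v ν σ g s₁ s₂ ε₂ ιC aC bC)
    (hv0 : (v : 𝔼 3) 0 = 0) (hv1 : (v : 𝔼 3) 1 = 0) {w₀ : 𝔼 2} (hw₀ : w₀ ≠ 0) (h1₀ : s₁ < sT w₀)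
    (h2₀ : sT w₀ < s₂) (x : Circle × Circle) : ΘT v ιT ιC aC bC w₀ w₀ x = x := by
  rw [ΘT, ΨT_ΦT hT hC hv0 hv1 hw₀ h1₀ h2₀, Diffeomorph.apply_symm_apply]

/-- **The comparison map on the reference trivialisation**:
`ΘT w₀ w (Ψ0 w₀ θ) = (aC, bC) (ιT (θ, w))`. [folklore] -/
theorem ΘT_Ψ0 (hT : IsTorusSideProduct f v ιT) (hC : IsRigidCollar f v ν σ g s₁ s₂ ε₂ ιC aC bC)
    (hv0 : (v : 𝔼 3) 0 = 0) (hv1 : (v : 𝔼 3) 1 = 0) {w₀ : 𝔼 2} (hw₀ : w₀ ≠ 0) (h1₀ : s₁ < sT w₀)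
    (h2₀ : sT w₀ < s₂) (w : 𝔼 2) (θ : Fb) :
    ΘT v ιT ιC aC bC w₀ w (Ψ0 ιT aC bC w₀ θ) = torusDiffeo (ΨT ιT aC bC w θ) := by
  rw [ΘT, Ψ0, Diffeomorph.symm_apply_apply, ΦT_ΨT hT hC hv0 hv1 hw₀ h1₀ h2₀]

/-- First component: `(ΘT w₀ w (Ψ0 w₀ θ)).1 = toCircle (aC (ιT (θ, w)))`. [folklore] -/
theorem ΘT_Ψ0_fst (hT : IsTorusSideProduct f v ιT) (hC : IsRigidCollar f v ν σ g s₁ s₂ ε₂ ιC aC bC)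
    (hv0 : (v : 𝔼 3) 0 = 0) (hv1 : (v : 𝔼 3) 1 = 0) {w₀ : 𝔼 2} (hw₀ : w₀ ≠ 0) (h1₀ : s₁ < sT w₀)
    (h2₀ : sT w₀ < s₂) (w : 𝔼 2) (θ : Fb) :
    (ΘT v ιT ιC aC bC w₀ w (Ψ0 ιT aC bC w₀ θ)).1 = toCircle (aC (ιT (θ, w))) := by
  rw [ΘT_Ψ0 hT hC hv0 hv1 hw₀ h1₀ h2₀]; rfl

/-- **Joint smoothness of `(w, x) ↦ ΘT w₀ w x` over the band annulus.** [folklore] -/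
theorem contMDiffOn_ΘT (hT : IsTorusSideProduct f v ιT) (hC : IsRigidCollar f v ν σ g s₁ s₂ ε₂ ιC aC bC)
    (hv0 : (v : 𝔼 3) 0 = 0) (hv1 : (v : 𝔼 3) 1 = 0) {w₀ : 𝔼 2} (h1₀ : s₁ < sT w₀) (h2₀ : sT w₀ < s₂) :
    ContMDiffOn (𝓘(ℝ, 𝔼 2).prod 𝓣) 𝓣 ∞ (fun q : 𝔼 2 × (Circle × Circle) ↦ ΘT v ιT ιC aC bC w₀ q.1 q.2)
      ({w : 𝔼 2 | s₁ < sT w ∧ sT w < s₂} ×ˢ univ) := by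
  have h1 : ContMDiff (𝓘(ℝ, 𝔼 2).prod 𝓣) ((𝓡 2).prod (𝓡 2)) ∞
      fun q : 𝔼 2 × (Circle × Circle) ↦ ((ΦT v ιT ιC w₀ (torusDiffeo.symm q.2), q.1) : Fb × 𝔼 2) :=
    (((contMDiff_ΦT hT hC hv0 hv1 h1₀ h2₀).comp torusDiffeo.symm.contMDiff).comp contMDiff_snd).prodMk
      contMDiff_fst
  have h2 : ContMDiffOn (𝓘(ℝ, 𝔼 2).prod 𝓣) ((𝓡 1).prod (𝓡 1)) ∞
      (fun q : 𝔼 2 × (Circle × Circle) ↦ ΨT ιT aC bC q.1 (ΦT v ιT ιC w₀ (torusDiffeo.symm q.2)))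
      ({w : 𝔼 2 | s₁ < sT w ∧ sT w < s₂} ×ˢ univ) :=
    (contMDiffOn_ΨT hT hC hv0 hv1).comp h1.contMDiffOn
      fun q (hq : q ∈ {w : 𝔼 2 | s₁ < sT w ∧ sT w < s₂} ×ˢ (univ : Set (Circle × Circle))) ↦
        ⟨mem_univ _, hq.1⟩
  exact torusDiffeo.contMDiff.comp_contMDiffOn h2

/-- `ΘT w₀ w` is smooth for `w` in the band annulus. [folklore] -/
theorem contMDiff_ΘT (hT : IsTorusSideProduct f v ιT) (hC : IsRigidCollar f v ν σ g s₁ s₂ ε₂ ιC aC bC)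
    (hv0 : (v : 𝔼 3) 0 = 0) (hv1 : (v : 𝔼 3) 1 = 0) {w₀ w : 𝔼 2} (h1₀ : s₁ < sT w₀) (h2₀ : sT w₀ < s₂)
    (h1 : s₁ < sT w) (h2 : sT w < s₂) : ContMDiff 𝓣 𝓣 ∞ (ΘT v ιT ιC aC bC w₀ w) :=
  torusDiffeo.contMDiff.comp (((contMDiff_ΨT hT hC hv0 hv1 h1 h2).comp
    (contMDiff_ΦT hT hC hv0 hv1 h1₀ h2₀)).comp torusDiffeo.symm.contMDiff)

/-- `ΘTinv w₀ w` is smooth for `w` in the band annulus. [folklore] -/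
theorem contMDiff_ΘTinv (hT : IsTorusSideProduct f v ιT) (hC : IsRigidCollar f v ν σ g s₁ s₂ ε₂ ιC aC bC)
    (hv0 : (v : 𝔼 3) 0 = 0) (hv1 : (v : 𝔼 3) 1 = 0) {w₀ w : 𝔼 2} (h1₀ : s₁ < sT w₀) (h2₀ : sT w₀ < s₂)
    (h1 : s₁ < sT w) (h2 : sT w < s₂) : ContMDiff 𝓣 𝓣 ∞ (ΘTinv v ιT ιC aC bC w₀ w) :=
  torusDiffeo.contMDiff.comp (((contMDiff_ΨT hT hC hv0 hv1 h1₀ h2₀).comp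
    (contMDiff_ΦT hT hC hv0 hv1 h1 h2)).comp torusDiffeo.symm.contMDiff)

/-- **Each comparison map has surjective differential** (it is a diffeomorphism of `T`). [folklore] -/
theorem surjective_mfderiv_ΘT (hT : IsTorusSideProduct f v ιT) (hC : IsRigidCollar f v ν σ g s₁ s₂ ε₂ ιC aC bC)
    (hv0 : (v : 𝔼 3) 0 = 0) (hv1 : (v : 𝔼 3) 1 = 0) {w₀ w : 𝔼 2} (hw₀ : w₀ ≠ 0) (h1₀ : s₁ < sT w₀)
    (h2₀ : sT w₀ < s₂) (hw : w ≠ 0) (h1 : s₁ < sT w) (h2 : sT w < s₂) (x : Circle × Circle) :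
    Surjective (mfderiv 𝓣 𝓣 (ΘT v ιT ιC aC bC w₀ w) x) :=
  surjective_mfderiv_of_inverse (contMDiff_ΘT hT hC hv0 hv1 h1₀ h2₀ h1 h2).contMDiffAt
    (contMDiff_ΘTinv hT hC hv0 hv1 h1₀ h2₀ h1 h2).contMDiffAt
    (ΘTinv_ΘT hT hC hv0 hv1 hw₀ h1₀ h2₀ hw h1 h2 x) (ΘT_ΘTinv hT hC hv0 hv1 hw₀ h1₀ h2₀ hw h1 h2)

/-! ### Along a base circle -/

/-- **`(t, x) ↦ ΘT w₀ (R • circlePt (l t)) x` is jointly smooth** for a smooth `l : ℝ → ℝ`, when the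
circle of radius `R > 0` lies in the band annulus. [folklore] -/
theorem contMDiff_ΘT_circle (hT : IsTorusSideProduct f v ιT) (hC : IsRigidCollar f v ν σ g s₁ s₂ ε₂ ιC aC bC)
    (hv0 : (v : 𝔼 3) 0 = 0) (hv1 : (v : 𝔼 3) 1 = 0) {w₀ : 𝔼 2} (h1₀ : s₁ < sT w₀) (h2₀ : sT w₀ < s₂)
    {R : ℝ} (h1 : s₁ < (1 + 2 * R ^ 2)⁻¹) (h2 : (1 + 2 * R ^ 2)⁻¹ < s₂) {l : ℝ → ℝ}
    (hl : ContDiff ℝ ∞ l) :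
    ContMDiff (𝓘(ℝ, ℝ).prod 𝓣) 𝓣 ∞ fun q : ℝ × (Circle × Circle) ↦
      ΘT v ιT ιC aC bC w₀ (R • ((circlePt (l q.1) : 𝕊¹) : 𝔼 2)) q.2 := by
  have hc' : ContMDiff 𝓘(ℝ, ℝ) 𝓘(ℝ, 𝔼 2) ∞ fun t : ℝ ↦ ((circlePt (l t) : 𝕊¹) : 𝔼 2) :=
    contMDiff_coe_sphere.comp (contMDiff_circlePt.comp hl.contMDiff)
  have hc : ContMDiff 𝓘(ℝ, ℝ) 𝓘(ℝ, 𝔼 2) ∞ fun t : ℝ ↦ R • ((circlePt (l t) : 𝕊¹) : 𝔼 2) :=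
    ((contDiff_const (c := R)).smul (contMDiff_iff_contDiff.1 hc')).contMDiff
  have hin : ContMDiff (𝓘(ℝ, ℝ).prod 𝓣) (𝓘(ℝ, 𝔼 2).prod 𝓣) ∞
      fun q : ℝ × (Circle × Circle) ↦ (R • ((circlePt (l q.1) : 𝕊¹) : 𝔼 2), q.2) :=
    (hc.comp contMDiff_fst).prodMk contMDiff_snd
  refine (contMDiffOn_ΘT hT hC hv0 hv1 h1₀ h2₀).comp_contMDiff hin fun q ↦ ⟨?_, mem_univ _⟩
  change s₁ < sT (R • _) ∧ sT (R • _) < s₂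
  rw [sT_smul_circlePt]
  exact ⟨h1, h2⟩

/-- **`(t, x) ↦ ΘTinv w₀ (R • circlePt (l t)) x` is jointly smooth** (the inverse family along a
base circle; this uses the joint smoothness of `ΦT` along circles). [folklore] -/
theorem contMDiff_ΘTinv_circle (hT : IsTorusSideProduct f v ιT) (hC : IsRigidCollar f v ν σ g s₁ s₂ ε₂ ιC aC bC)
    (hv0 : (v : 𝔼 3) 0 = 0) (hv1 : (v : 𝔼 3) 1 = 0) {w₀ : 𝔼 2} (h1₀ : s₁ < sT w₀) (h2₀ : sT w₀ < s₂)
    {R : ℝ} (hR : 0 < R) (h1 : s₁ < (1 + 2 * R ^ 2)⁻¹) (h2 : (1 + 2 * R ^ 2)⁻¹ < s₂) {l : ℝ → ℝ}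
    (hl : ContDiff ℝ ∞ l) :
    ContMDiff (𝓘(ℝ, ℝ).prod 𝓣) 𝓣 ∞ fun q : ℝ × (Circle × Circle) ↦
      ΘTinv v ιT ιC aC bC w₀ (R • ((circlePt (l q.1) : 𝕊¹) : 𝔼 2)) q.2 := by
  have hΦ := contMDiff_ΦT_circle hT hC hv0 hv1 hR h1 h2
  have hin : ContMDiff (𝓘(ℝ, ℝ).prod 𝓣) (𝓘(ℝ, ℝ).prod 𝓣) ∞
      fun q : ℝ × (Circle × Circle) ↦ ((l q.1, torusDiffeo.symm q.2) : ℝ × (𝕊¹ × 𝕊¹)) :=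
    ((hl.contMDiff.comp contMDiff_fst).prodMk (torusDiffeo.symm.contMDiff.comp contMDiff_snd))
  exact torusDiffeo.contMDiff.comp ((contMDiff_ΨT hT hC hv0 hv1 h1₀ h2₀).comp (hΦ.comp hin))

/-! ### The flattened loop of a base circle as a diffeotopy of `T` -/

/-- **The loop of comparison maps along the base circle through `w₀ = R • circlePt 0`, flattened**:
stages `t ↦ ΘT w₀ (R • circlePt (stepQ t))`, a diffeotopy of `T = Circle × Circle` equal to the
identity for `t ≤ 1/4` and for `t ≥ 3/4`. [folklore] -/
def loopD (hT : IsTorusSideProduct f v ιT) (hC : IsRigidCollar f v ν σ g s₁ s₂ ε₂ ιC aC bC)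
    (hv0 : (v : 𝔼 3) 0 = 0) (hv1 : (v : 𝔼 3) 1 = 0) {R : ℝ} (hR : 0 < R)
    (h1 : s₁ < (1 + 2 * R ^ 2)⁻¹) (h2 : (1 + 2 * R ^ 2)⁻¹ < s₂) : Diffeotopy 𝓣 (Circle × Circle) :=
  have hw₀ : (R • ((circlePt 0 : 𝕊¹) : 𝔼 2)) ≠ 0 := by
    rw [← norm_ne_zero_iff, norm_smul, norm_eq_of_mem_sphere (circlePt 0), mul_one, Real.norm_eq_abs,
      abs_of_pos hR]
    exact hR.ne'
  have h1₀ : s₁ < sT (R • ((circlePt 0 : 𝕊¹) : 𝔼 2)) := by rw [sT_smul_circlePt]; exact h1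
  have h2₀ : sT (R • ((circlePt 0 : 𝕊¹) : 𝔼 2)) < s₂ := by rw [sT_smul_circlePt]; exact h2
  Diffeotopy.mk' 𝓣
    (fun t x ↦ ΘT v ιT ιC aC bC (R • ((circlePt 0 : 𝕊¹) : 𝔼 2)) (R • ((circlePt (stepQ t) : 𝕊¹) : 𝔼 2)) x)
    (fun t x ↦ ΘTinv v ιT ιC aC bC (R • ((circlePt 0 : 𝕊¹) : 𝔼 2)) (R • ((circlePt (stepQ t) : 𝕊¹) : 𝔼 2)) x)
    (contMDiff_ΘT_circle hT hC hv0 hv1 h1₀ h2₀ h1 h2 contDiff_stepQ)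
    (contMDiff_ΘTinv_circle hT hC hv0 hv1 h1₀ h2₀ hR h1 h2 contDiff_stepQ)
    (fun t x ↦ ΘTinv_ΘT hT hC hv0 hv1 hw₀ h1₀ h2₀ (smul_circlePt_ne_zero' hR _)
      (by rw [sT_smul_circlePt]; exact h1) (by rw [sT_smul_circlePt]; exact h2) x)
    (fun t x ↦ ΘT_ΘTinv hT hC hv0 hv1 hw₀ h1₀ h2₀ (smul_circlePt_ne_zero' hR _)
      (by rw [sT_smul_circlePt]; exact h1) (by rw [sT_smul_circlePt]; exact h2) x)
    (by funext x; rw [stepQ_zero]; exact ΘT_self hT hC hv0 hv1 hw₀ h1₀ h2₀ x)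
where
  /-- `R • circlePt t ≠ 0` for `R > 0` (local copy for the `where` clause). [folklore] -/
  smul_circlePt_ne_zero' {R : ℝ} (hR : 0 < R) (t : ℝ) : R • ((circlePt t : 𝕊¹) : 𝔼 2) ≠ 0 := by
    rw [← norm_ne_zero_iff, norm_smul, norm_eq_of_mem_sphere (circlePt t), mul_one, Real.norm_eq_abs,
      abs_of_pos hR]
    exact hR.ne'

/-- Stages of `loopD`. [folklore] -/
theorem loopD_toFun (hT : IsTorusSideProduct f v ιT) (hC : IsRigidCollar f v ν σ g s₁ s₂ ε₂ ιC aC bC)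
    (hv0 : (v : 𝔼 3) 0 = 0) (hv1 : (v : 𝔼 3) 1 = 0) {R : ℝ} (hR : 0 < R)
    (h1 : s₁ < (1 + 2 * R ^ 2)⁻¹) (h2 : (1 + 2 * R ^ 2)⁻¹ < s₂) (t : ℝ) (x : Circle × Circle) :
    (loopD hT hC hv0 hv1 hR h1 h2).toFun t x =
      ΘT v ιT ιC aC bC (R • ((circlePt 0 : 𝕊¹) : 𝔼 2)) (R • ((circlePt (stepQ t) : 𝕊¹) : 𝔼 2)) x := rfl

/-- **`loopD` is a based loop**: its stages are the identity for `t ≤ 1/4`. [folklore] -/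
theorem loopD_toFun_of_le (hT : IsTorusSideProduct f v ιT) (hC : IsRigidCollar f v ν σ g s₁ s₂ ε₂ ιC aC bC)
    (hv0 : (v : 𝔼 3) 0 = 0) (hv1 : (v : 𝔼 3) 1 = 0) {R : ℝ} (hR : 0 < R)
    (h1 : s₁ < (1 + 2 * R ^ 2)⁻¹) (h2 : (1 + 2 * R ^ 2)⁻¹ < s₂) {t : ℝ} (ht : t ≤ 1 / 4) :
    (loopD hT hC hv0 hv1 hR h1 h2).toFun t = id := by
  funext x
  rw [loopD_toFun, stepQ_of_le ht]
  exact ΘT_self hT hC hv0 hv1 (loopD.smul_circlePt_ne_zero' hR 0) (by rw [sT_smul_circlePt]; exact h1)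
    (by rw [sT_smul_circlePt]; exact h2) x

/-- **`loopD` is a based loop**: its stages are the identity for `t ≥ 3/4`. [folklore] -/
theorem loopD_toFun_of_ge (hT : IsTorusSideProduct f v ιT) (hC : IsRigidCollar f v ν σ g s₁ s₂ ε₂ ιC aC bC)
    (hv0 : (v : 𝔼 3) 0 = 0) (hv1 : (v : 𝔼 3) 1 = 0) {R : ℝ} (hR : 0 < R)
    (h1 : s₁ < (1 + 2 * R ^ 2)⁻¹) (h2 : (1 + 2 * R ^ 2)⁻¹ < s₂) {t : ℝ} (ht : 3 / 4 ≤ t) :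
    (loopD hT hC hv0 hv1 hR h1 h2).toFun t = id := by
  funext x
  have hper : circlePt (1 : ℝ) = circlePt 0 := by simpa using circlePt_add_one 0
  rw [loopD_toFun, stepQ_of_ge ht, hper]
  exact ΘT_self hT hC hv0 hv1 (loopD.smul_circlePt_ne_zero' hR 0) (by rw [sT_smul_circlePt]; exact h1)
    (by rw [sT_smul_circlePt]; exact h2) x

/-- **Evaluation of the loop on the reference trivialisation**:
`(loopD_t (Ψ0 w₀ θ)).1 = toCircle (aC (ιT (θ, R • circlePt (stepQ t))))`. [folklore] -/
theorem loopD_toFun_Ψ0_fst (hT : IsTorusSideProduct f v ιT) (hC : IsRigidCollar f v ν σ g s₁ s₂ ε₂ ιC aC bC)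
    (hv0 : (v : 𝔼 3) 0 = 0) (hv1 : (v : 𝔼 3) 1 = 0) {R : ℝ} (hR : 0 < R)
    (h1 : s₁ < (1 + 2 * R ^ 2)⁻¹) (h2 : (1 + 2 * R ^ 2)⁻¹ < s₂) (t : ℝ) (θ : Fb) :
    ((loopD hT hC hv0 hv1 hR h1 h2).toFun t (Ψ0 ιT aC bC (R • ((circlePt 0 : 𝕊¹) : 𝔼 2)) θ)).1 =
      toCircle (aC (ιT (θ, R • ((circlePt (stepQ t) : 𝕊¹) : 𝔼 2)))) := by
  rw [loopD_toFun]
  exact ΘT_Ψ0_fst hT hC hv0 hv1 (loopD.smul_circlePt_ne_zero' hR 0) (by rw [sT_smul_circlePt]; exact h1)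
    (by rw [sT_smul_circlePt]; exact h2) _ θ

end Setup

end DiscExt

end Summit.SmoothPoincare4.SmoothPoincare4.Cruxes.RungOne.Sketch

end
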